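import Literature.Analysis.FluidPDE.TaoAnnulusAssembly
import HarnessLib

/-!
# Tao (2011/2013), Thm. 10.1 in the exterior form of Remark 10.6
# (`tao2011_enstrophyLocalisation_exterior`): its leaf structure after `TaoAnnulusAssembly`

`Literature.Analysis.FluidPDE.tao2011_enstrophyLocalisation_exterior` (`TaoEnstrophyLocalisation.lean`;
Tao 2011, arXiv:1108.1165, Thm. 10.1 = arXiv Thm. 59 with Remark 10.6 = arXiv Rem. 64, general
viscosity `ν > 0`, `f = 0`) is the named fact through which Cor. 11.1 (bounded enstrophy), the
composite `tao2011_hasBoundedSobolevNormsOn` and the vendored forms of Cor. 11.4 were first reduced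
(`tao2011_boundedEnstrophy_of_parts`, `tao2011_hasBoundedSobolevNormsOn_of_enstrophyLocalisation`,
`tao_unconditional_uniqueness_velocity_of_enstrophyLocalisation`). The later layers of the tree
decompose it along the printed proof (`TaoEnstrophyLocalisationParts`: Lemma 8.1 + Prop. 9.1 + the
§10 a priori form; `TaoUnitViscosity`: `ν = 1`; `TaoEnstrophyLocalisationAnnulus`: annuli and
monotone convergence; `TaoBoundedTotalSpeed`: the a priori / Duhamel split of Prop. 9.1;
`TaoAnnulusAssembly`: the §10 argument from the `Y₆` estimate), but record the resulting leaf
structure only for Cor. 11.1 / Cor. 11.4. This file records it for the exterior theorem itself: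

* `tao2011_boundedTotalSpeed_of_duhamel :
    tao2011_duhamelNonlinearSpeed_unit → tao2011_boundedTotalSpeed` (Prop. 9.1 for every `ν > 0`
  from the nonlinear Duhamel leaf: Lemma 8.1 proved, dispersive part proved, rescaling proved);
* `tao2011_enstrophyLocalisation_exterior_apriori_of_nonlinearEstimate :
    tao2011_nonlinearEstimate → tao2011_enstrophyLocalisation_exterior_apriori`;
* `tao2011_enstrophyLocalisation_exterior_of_nonlinearEstimate_of_duhamel :
    tao2011_nonlinearEstimate → tao2011_duhamelNonlinearSpeed_unit →
    tao2011_enstrophyLocalisation_exterior`.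

So Thm. 10.1 (exterior form, all `ν > 0`) follows from exactly the two analytic leaves
`tao2011_nonlinearEstimate` (§10, the estimate for the nonlinear term `Y₆`) and
`tao2011_duhamelNonlinearSpeed_unit` (§9, the total speed of the nonlinear Duhamel component);
discharging them yields `tao2011_enstrophyLocalisation_exterior_holds` by this file. No statement
is modified and no definition is introduced.

## Mathlib / tree search

`lean search 'enstrophyLocalisation_exterior_of'`: `_of_parts` (Parts), `_of_unit` (UnitViscosity),
`_apriori_unit_of_annulus`, `_apriori_unit_of_nonlinearEstimate` (AnnulusAssembly) — no assembly of the
exterior theorem from the two leaves. Reused, not restated: `tao2011_enstrophyLocalisation_exterior_of_parts`,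
`tao_finite_energy_smooth_energy_bound_holds`, `tao2011_boundedTotalSpeed_of_unit`,
`tao2011_boundedTotalSpeed_unit_of_apriori`, `tao2011_boundedTotalSpeed_apriori_unit_of_duhamel`,
`tao2011_enstrophyLocalisation_exterior_apriori_of_unit`,
`tao2011_enstrophyLocalisation_exterior_apriori_unit_of_nonlinearEstimate`.

## References

* T. Tao, *Localisation and compactness properties of the Navier–Stokes global regularity
  problem*, Anal. PDE 6 (2013) 25–107 = arXiv:1108.1165 (`Tao2011`): Thm. 10.1 and its proof
  (arXiv Thm. 59, §10, pp. 30–33), Remark 10.6 (arXiv Rem. 64, p. 33), Prop. 9.1 (arXiv Prop. 52,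
  §9, pp. 27–28), Lemma 8.1 (arXiv Lemma 44), footnote 3 (rescaling of the viscosity).
-/

noncomputable section

namespace Literature.Analysis.FluidPDE

/-- **Prop. 9.1 (bounded total speed) for every `ν > 0`, from the nonlinear Duhamel leaf**:
Lemma 8.1 (`tao_finite_energy_smooth_energy_bound_holds`) and the proved dispersive part give the
unit-viscosity statement from `tao2011_duhamelNonlinearSpeed_unit`
(`tao2011_boundedTotalSpeed_unit_of_apriori`, `tao2011_boundedTotalSpeed_apriori_unit_of_duhamel`),
and the footnote-3 rescaling (`tao2011_boundedTotalSpeed_of_unit`) gives all `ν > 0`. [cite: Tao2011, Prop. 9.1] -/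
theorem tao2011_boundedTotalSpeed_of_duhamel (hN : tao2011_duhamelNonlinearSpeed_unit) :
    tao2011_boundedTotalSpeed :=
  tao2011_boundedTotalSpeed_of_unit (tao2011_boundedTotalSpeed_unit_of_apriori
    tao_finite_energy_smooth_energy_bound_holds (tao2011_boundedTotalSpeed_apriori_unit_of_duhamel hN))

/-- **The §10 a priori form of Thm. 10.1 (exterior region, every `ν > 0`) from the `Y₆` estimate**:
the annular unit-viscosity assembly (`tao2011_enstrophyLocalisation_exterior_apriori_unit_of_nonlinearEstimate`,
with the proved passage to the exterior region by monotone convergence) and the footnote-3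
rescaling (`tao2011_enstrophyLocalisation_exterior_apriori_of_unit`). [cite: Tao2011, Thm. 10.1 (proof, §10) + Remark 10.6] -/
theorem tao2011_enstrophyLocalisation_exterior_apriori_of_nonlinearEstimate
    (hY : tao2011_nonlinearEstimate) : tao2011_enstrophyLocalisation_exterior_apriori :=
  tao2011_enstrophyLocalisation_exterior_apriori_of_unit
    (tao2011_enstrophyLocalisation_exterior_apriori_unit_of_nonlinearEstimate hY)

/-- **Tao 2011, Thm. 10.1 in the exterior form of Remark 10.6, from its two remaining analytic
leaves** — the nonlinear estimate for `Y₆` (§10) and the total speed of the nonlinear Duhamel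
component (§9): `tao2011_enstrophyLocalisation_exterior_of_parts` with Lemma 8.1 discharged,
Prop. 9.1 from `tao2011_boundedTotalSpeed_of_duhamel` and the a priori form from
`tao2011_enstrophyLocalisation_exterior_apriori_of_nonlinearEstimate`. [cite: Tao2011, Thm. 10.1 + Remark 10.6] -/
theorem tao2011_enstrophyLocalisation_exterior_of_nonlinearEstimate_of_duhamel
    (hY : tao2011_nonlinearEstimate) (hN : tao2011_duhamelNonlinearSpeed_unit) :
    tao2011_enstrophyLocalisation_exterior :=
  tao2011_enstrophyLocalisation_exterior_of_parts tao_finite_energy_smooth_energy_bound_holds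
    (tao2011_boundedTotalSpeed_of_duhamel hN)
    (tao2011_enstrophyLocalisation_exterior_apriori_of_nonlinearEstimate hY)

end Literature.Analysis.FluidPDE

end
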